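import Summits.ValiantsHypothesis.ValiantsHypothesis.Theorems.KPlusLogSqLawValuativeDoorRoofEngine

/-!
# LINE `valuative_door` (crux `WeakLifting`, stmt-ValiantsHypothesis-19561) — THE ROOF-EXCESS LEMMA:
# on a support without three-term progressions EVERY polarised Gram entry lies under every concave roof of the Newton polygon,
# and an entry of a cancelling class can touch the roof only strictly between the two touching classes

HONEST FRAMING.  Helper (cell `pub-symmetroid`, seat val-sym-lift-p1 g25, 2026-08-29; `--supports 19561 --as helper`).  Width two, ALL
`K`, every field, every non-archimedean `v`, symmetric letters, strictly increasing exponents WITHOUT THREE-TERM PROGRESSIONS.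
`log_polar_le_roof`: for ANY roof `h t = min (p + q t) (p' + q' t)` with `log v(f_E) ≤ h(E)` on the support of the determinant `f`,
every nonzero polarised Gram entry has `log v(G_{ij}) ≤ h(d_i + d_j)` — although the class coefficient of a four-letter coincidence
class may be much smaller than its entries.  Proof: a cell of maximal excess `μ > 0` and maximal class exponent is diagonal (excess
`≤ log v(2) ≤ 0`), tame (`v(G) ≤ v(f_class)`, excess `≤ 0`) or wild-and-extremal — excluded by the engine ✓ `false_of_wild_tying_extremal`.
`touching_polar_between`: if moreover `log v(f_E) < h(E)` strictly off two exponents `B`, `C`, a nonzero entry touching the roof has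
class exponent `B` or `C`, or is an off-diagonal entry with exponent strictly between them (engine at level `μ = 0`, maximal exponent
beyond `max B C` / minimal below `min B C`).  Consumed by `…APFreeLaw`.  Nothing here is a stub of the line or closes anything; no
bearing on vW / vB, `TropicalB`, `MatrixDescartes` (18050) or VP ≠ VNP.  [max-excess propagation]
-/

set_option linter.dupNamespace false
set_option autoImplicit false

namespace Summit.ValiantsHypothesis.ValiantsHypothesis.Theorems.KPlusLogSqLaw.ValDoor

open Polynomial Finset Matrix
open scoped BigOperators Classical

variable {F : Type*} [Field F]

/-! ## §1 Every entry lies under the roof -/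

/-- **THE ROOF-EXCESS LEMMA.**  For a symmetric `2 × 2` lacunary pencil on a support WITHOUT THREE-TERM PROGRESSIONS (strictly
increasing exponents) over a non-archimedean field, and ANY concave roof `h t = min (p + q t) (p' + q' t)` majorising `log v` of the
determinant's coefficients on its support, EVERY nonzero polarised Gram entry `G_{ij} = a_i c_j + a_j c_i − 2 b_i b_j` satisfies
`log v(G_{ij}) ≤ h(d_i + d_j)` — although on a non-Sidon support the class coefficient `Σ_{pairs} G` does NOT control its entries (a
four-letter coincidence `d_x + d_w = d_y + d_z` may cancel).  Proof: a cell of maximal excess `μ > 0` with maximal class exponent is a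
diagonal cell (excess `≤ log v(2) ≤ 0`, ✓ `coeff_diag_of_apfree`), or tame (`v(G) ≤ v(coefficient)`, excess `≤ 0`), or wild and extremal —
excluded by the engine `false_of_wild_tying_extremal`. [max-excess propagation] -/
theorem log_polar_le_roof (v : AbsoluteValue F ℝ) (hv : IsNonarchimedean v) {K : ℕ} (d : Fin K → ℕ)
    (hd : StrictMono d) (S : Fin K → Matrix (Fin 2) (Fin 2) F) (hS : ∀ l, (S l).IsSymm)
    (hap : ∀ l₁ l₂ l₃ : Fin K, d l₁ + d l₂ = d l₃ + d l₃ → l₁ = l₃ ∧ l₂ = l₃)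
    (p q p' q' : ℝ)
    (hmaj : ∀ E ∈ (Matrix.det (∑ l, ((X : F[X]) ^ d l) • (S l).map (C : F →+* F[X]))).support,
      Real.log (v ((Matrix.det (∑ l, ((X : F[X]) ^ d l) • (S l).map (C : F →+* F[X]))).coeff E))
        ≤ min (p + q * (E : ℝ)) (p' + q' * (E : ℝ))) :
    ∀ i j : Fin K, S i 0 0 * S j 1 1 + S j 0 0 * S i 1 1 - 2 * S i 0 1 * S j 0 1 ≠ 0 →
      Real.log (v (S i 0 0 * S j 1 1 + S j 0 0 * S i 1 1 - 2 * S i 0 1 * S j 0 1))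
        ≤ min (p + q * ((d i + d j : ℕ) : ℝ)) (p' + q' * ((d i + d j : ℕ) : ℝ)) := by
  set f : F[X] := Matrix.det (∑ l, ((X : F[X]) ^ d l) • (S l).map (C : F →+* F[X])) with hf
  set Gm : Fin K → Fin K → F := fun i j => S i 0 0 * S j 1 1 + S j 0 0 * S i 1 1 - 2 * S i 0 1 * S j 0 1 with hGm
  set h : ℝ → ℝ := fun t => min (p + q * t) (p' + q' * t) with hh
  show ∀ i j : Fin K, Gm i j ≠ 0 → Real.log (v (Gm i j)) ≤ h ((d i + d j : ℕ) : ℝ)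
  by_contra hno
  push Not at hno
  obtain ⟨i₁, j₁, hG₁, hlt₁⟩ := hno
  have hGsymm : ∀ i j, Gm i j = Gm j i := fun i j => by simp only [hGm]; ring
  -- cells, excess, the maximal excess `μ > 0`
  set cells : Finset (Fin K × Fin K) := (univ : Finset (Fin K × Fin K)).filter fun c => Gm c.1 c.2 ≠ 0 with hcells
  set ex : Fin K × Fin K → ℝ := fun c => Real.log (v (Gm c.1 c.2)) - h ((d c.1 + d c.2 : ℕ) : ℝ) with hex
  have hmem₁ : (i₁, j₁) ∈ cells := Finset.mem_filter.2 ⟨Finset.mem_univ _, hG₁⟩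
  have hne : cells.Nonempty := ⟨_, hmem₁⟩
  set μ : ℝ := cells.sup' hne ex with hμ
  have hle : ∀ i j, Gm i j ≠ 0 → Real.log (v (Gm i j)) ≤ h ((d i + d j : ℕ) : ℝ) + μ := by
    intro i j hG
    have : ex (i, j) ≤ μ := Finset.le_sup' ex (Finset.mem_filter.2 ⟨Finset.mem_univ _, hG⟩)
    simp only [hex] at this
    linarith
  have hμpos : 0 < μ := by
    have : ex (i₁, j₁) ≤ μ := Finset.le_sup' ex hmem₁
    simp only [hex] at this
    linarith
  -- tying cells and one of maximal class exponent
  set T : Finset (Fin K × Fin K) := cells.filter fun c => Real.log (v (Gm c.1 c.2)) = h ((d c.1 + d c.2 : ℕ) : ℝ) + μ with hT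
  have hTne : T.Nonempty := by
    obtain ⟨c, hc, hcμ⟩ := Finset.exists_mem_eq_sup' hne ex
    refine ⟨c, Finset.mem_filter.2 ⟨hc, ?_⟩⟩
    have : ex c = μ := by rw [hμ, hcμ]
    simp only [hex] at this
    linarith
  obtain ⟨c₀, hc₀T, hc₀max⟩ := Finset.exists_max_image T (fun c : Fin K × Fin K => d c.1 + d c.2) hTne
  obtain ⟨hc₀cells, hc₀tie⟩ := Finset.mem_filter.1 hc₀T
  have hc₀G : Gm c₀.1 c₀.2 ≠ 0 := (Finset.mem_filter.1 hc₀cells).2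
  -- not a diagonal cell
  have hoff : c₀.1 ≠ c₀.2 := by
    intro heq
    have hGdiag : Gm c₀.1 c₀.2 = 2 * (S c₀.1 0 0 * S c₀.1 1 1 - S c₀.1 0 1 * S c₀.1 0 1) := by
      simp only [hGm]; rw [← heq]; ring
    have hcoeff : f.coeff (d c₀.1 + d c₀.1) = S c₀.1 0 0 * S c₀.1 1 1 - S c₀.1 0 1 * S c₀.1 0 1 :=
      coeff_diag_of_apfree d S hS hap c₀.1
    have hdet0 : S c₀.1 0 0 * S c₀.1 1 1 - S c₀.1 0 1 * S c₀.1 0 1 ≠ 0 := fun h0 => hc₀G (by rw [hGdiag, h0, mul_zero])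
    have h2 : (2 : F) ≠ 0 := fun h0 => hc₀G (by rw [hGdiag, h0, zero_mul])
    have hsupp : (d c₀.1 + d c₀.1) ∈ f.support := Polynomial.mem_support_iff.2 (by rw [hcoeff]; exact hdet0)
    have hm := hmaj _ hsupp
    rw [hcoeff] at hm
    have hlog : Real.log (v (Gm c₀.1 c₀.2)) = Real.log (v 2) + Real.log (v (S c₀.1 0 0 * S c₀.1 1 1 - S c₀.1 0 1 * S c₀.1 0 1)) := by
      rw [hGdiag, map_mul, Real.log_mul (v.ne_zero h2) (v.ne_zero hdet0)]
    have hlog2 : Real.log (v 2) ≤ 0 := Real.log_nonpos (v.nonneg _) (abv_two_le_one v hv)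
    have htie := hc₀tie
    rw [hlog] at htie
    have : h ((d c₀.1 + d c₀.2 : ℕ) : ℝ) = h ((d c₀.1 + d c₀.1 : ℕ) : ℝ) := by rw [← heq]
    rw [this] at htie
    have hm' : Real.log (v (S c₀.1 0 0 * S c₀.1 1 1 - S c₀.1 0 1 * S c₀.1 0 1)) ≤ h ((d c₀.1 + d c₀.1 : ℕ) : ℝ) := by
      simpa only [hh] using hm
    linarith
  -- orient the cell: `a₀ < e₀`
  obtain ⟨a₀, e₀, hae₀, hG0, htie0, hsum0⟩ : ∃ a₀ e₀ : Fin K, a₀ < e₀ ∧ Gm a₀ e₀ ≠ 0 ∧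
      Real.log (v (Gm a₀ e₀)) = h ((d a₀ + d e₀ : ℕ) : ℝ) + μ ∧ d a₀ + d e₀ = d c₀.1 + d c₀.2 := by
    rcases lt_or_gt_of_ne hoff with h0 | h0
    · exact ⟨c₀.1, c₀.2, h0, hc₀G, hc₀tie, rfl⟩
    · refine ⟨c₀.2, c₀.1, h0, by rw [hGsymm]; exact hc₀G, ?_, Nat.add_comm _ _⟩
      rw [hGsymm, Nat.add_comm]; exact hc₀tie
  -- the cell is wild (else its excess would be `≤ 0`)
  have hwild : f.coeff (d a₀ + d e₀) = 0 ∨ v (f.coeff (d a₀ + d e₀)) < v (Gm a₀ e₀) := by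
    by_contra hno
    push Not at hno
    obtain ⟨hne0, hvle⟩ := hno
    have hsupp : (d a₀ + d e₀) ∈ f.support := Polynomial.mem_support_iff.2 hne0
    have hm := hmaj _ hsupp
    have hlog : Real.log (v (Gm a₀ e₀)) ≤ Real.log (v (f.coeff (d a₀ + d e₀))) := Real.log_le_log (v.pos hG0) hvle
    have hm' : Real.log (v (f.coeff (d a₀ + d e₀))) ≤ h ((d a₀ + d e₀ : ℕ) : ℝ) := by simpa only [hh] using hm
    linarith
  -- extremality: every tying cell has class exponent `≤ d a₀ + d e₀`
  have hdir : ∀ i j : Fin K, Gm i j ≠ 0 → Real.log (v (Gm i j)) = h ((d i + d j : ℕ) : ℝ) + μ → d i + d j ≤ d a₀ + d e₀ := by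
    intro i j hG hti
    have hT' : (i, j) ∈ T := Finset.mem_filter.2 ⟨Finset.mem_filter.2 ⟨Finset.mem_univ _, hG⟩, hti⟩
    rw [hsum0]
    exact hc₀max (i, j) hT'
  exact false_of_wild_tying_extremal v hv d hd S hS hap p q p' q' μ hle hae₀ hG0 htie0 hwild (Or.inl hdir)
/-! ## §2 Where a cancelling entry can touch the roof -/

/-- **A TOUCHING ENTRY OF A CANCELLING CLASS LIES STRICTLY BETWEEN THE TWO TOUCHING CLASSES.**  Same setting as
`log_polar_le_roof`, the roof now STRICTLY above `log v` of every support coefficient other than at two exponents `B`, `C`.  If a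
nonzero off-diagonal entry `G_{ij}` touches the roof (`log v(G_{ij}) = h(d_i + d_j)`) then its class exponent is `B` or `C` (tame class)
or lies strictly between `B` and `C`: a wild touching entry beyond `max B C` (or below `min B C`) of extremal exponent is excluded by the
engine `false_of_wild_tying_extremal` at level `μ = 0` (tame touching cells have exponent `B` or `C`, diagonal cells are tame by
`coeff_diag_of_apfree`). [max-excess propagation at level 0] -/
theorem touching_polar_between (v : AbsoluteValue F ℝ) (hv : IsNonarchimedean v) {K : ℕ} (d : Fin K → ℕ)
    (hd : StrictMono d) (S : Fin K → Matrix (Fin 2) (Fin 2) F) (hS : ∀ l, (S l).IsSymm)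
    (hap : ∀ l₁ l₂ l₃ : Fin K, d l₁ + d l₂ = d l₃ + d l₃ → l₁ = l₃ ∧ l₂ = l₃)
    (p q p' q' : ℝ) (B Cx : ℕ)
    (hmaj : ∀ E ∈ (Matrix.det (∑ l, ((X : F[X]) ^ d l) • (S l).map (C : F →+* F[X]))).support,
      Real.log (v ((Matrix.det (∑ l, ((X : F[X]) ^ d l) • (S l).map (C : F →+* F[X]))).coeff E))
        ≤ min (p + q * (E : ℝ)) (p' + q' * (E : ℝ)))
    (hmaj_lt : ∀ E ∈ (Matrix.det (∑ l, ((X : F[X]) ^ d l) • (S l).map (C : F →+* F[X]))).support, E ≠ B → E ≠ Cx →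
      Real.log (v ((Matrix.det (∑ l, ((X : F[X]) ^ d l) • (S l).map (C : F →+* F[X]))).coeff E))
        < min (p + q * (E : ℝ)) (p' + q' * (E : ℝ))) :
    ∀ i j : Fin K, S i 0 0 * S j 1 1 + S j 0 0 * S i 1 1 - 2 * S i 0 1 * S j 0 1 ≠ 0 →
      Real.log (v (S i 0 0 * S j 1 1 + S j 0 0 * S i 1 1 - 2 * S i 0 1 * S j 0 1))
        = min (p + q * ((d i + d j : ℕ) : ℝ)) (p' + q' * ((d i + d j : ℕ) : ℝ)) →
      (d i + d j = B ∨ d i + d j = Cx) ∨ (i ≠ j ∧ min B Cx < d i + d j ∧ d i + d j < max B Cx) := by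
  set f : F[X] := Matrix.det (∑ l, ((X : F[X]) ^ d l) • (S l).map (C : F →+* F[X])) with hf
  set Gm : Fin K → Fin K → F := fun i j => S i 0 0 * S j 1 1 + S j 0 0 * S i 1 1 - 2 * S i 0 1 * S j 0 1 with hGm
  set h : ℝ → ℝ := fun t => min (p + q * t) (p' + q' * t) with hh
  show ∀ i j : Fin K, Gm i j ≠ 0 → Real.log (v (Gm i j)) = h ((d i + d j : ℕ) : ℝ) →
      (d i + d j = B ∨ d i + d j = Cx) ∨ (i ≠ j ∧ min B Cx < d i + d j ∧ d i + d j < max B Cx)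
  have hGsymm : ∀ i j, Gm i j = Gm j i := fun i j => by simp only [hGm]; ring
  have hmaj' : ∀ E ∈ f.support, Real.log (v (f.coeff E)) ≤ h (E : ℝ) := fun E hE => by simpa only [hh] using hmaj E hE
  have hmaj_lt' : ∀ E ∈ f.support, E ≠ B → E ≠ Cx → Real.log (v (f.coeff E)) < h (E : ℝ) := fun E hE h1 h2 => by
    simpa only [hh] using hmaj_lt E hE h1 h2
  -- level-0 bound from the roof-excess lemma
  have hle0 : ∀ i j, Gm i j ≠ 0 → Real.log (v (Gm i j)) ≤ h ((d i + d j : ℕ) : ℝ) + 0 := by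
    intro i j hG
    rw [add_zero]
    exact log_polar_le_roof v hv d hd S hS hap p q p' q' hmaj i j hG
  -- a tame touching cell has class exponent `B` or `Cx`
  have htame : ∀ i j, Gm i j ≠ 0 → Real.log (v (Gm i j)) = h ((d i + d j : ℕ) : ℝ) →
      f.coeff (d i + d j) ≠ 0 → v (Gm i j) ≤ v (f.coeff (d i + d j)) → d i + d j = B ∨ d i + d j = Cx := by
    intro i j hG htie hne hvle
    by_contra hno
    push Not at hno
    have hsupp : (d i + d j) ∈ f.support := Polynomial.mem_support_iff.2 hne
    have h1 := hmaj_lt' _ hsupp hno.1 hno.2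
    have h2 : Real.log (v (Gm i j)) ≤ Real.log (v (f.coeff (d i + d j))) := Real.log_le_log (v.pos hG) hvle
    have h3 : h ((d i + d j : ℕ) : ℝ) = h ((d i + d j : ℕ) : ℝ) := rfl
    push_cast at h1 htie
    linarith
  -- diagonal cells are tame
  have hdiag : ∀ i, Gm i i ≠ 0 → f.coeff (d i + d i) ≠ 0 ∧ v (Gm i i) ≤ v (f.coeff (d i + d i)) := by
    intro i hG
    have hGdiag : Gm i i = 2 * (S i 0 0 * S i 1 1 - S i 0 1 * S i 0 1) := by simp only [hGm]; ring
    have hcoeff : f.coeff (d i + d i) = S i 0 0 * S i 1 1 - S i 0 1 * S i 0 1 := coeff_diag_of_apfree d S hS hap i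
    have hdet0 : S i 0 0 * S i 1 1 - S i 0 1 * S i 0 1 ≠ 0 := fun h0 => hG (by rw [hGdiag, h0, mul_zero])
    refine ⟨by rw [hcoeff]; exact hdet0, ?_⟩
    rw [hcoeff, hGdiag, map_mul]
    calc v 2 * v (S i 0 0 * S i 1 1 - S i 0 1 * S i 0 1) ≤ 1 * v (S i 0 0 * S i 1 1 - S i 0 1 * S i 0 1) :=
          mul_le_mul_of_nonneg_right (abv_two_le_one v hv) (v.nonneg _)
      _ = _ := one_mul _
  -- every touching cell: class `B`/`Cx`, or wild off-diagonal
  have hsplit : ∀ i j, Gm i j ≠ 0 → Real.log (v (Gm i j)) = h ((d i + d j : ℕ) : ℝ) →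
      (d i + d j = B ∨ d i + d j = Cx) ∨
      (i ≠ j ∧ (f.coeff (d i + d j) = 0 ∨ v (f.coeff (d i + d j)) < v (Gm i j))) := by
    intro i j hG htie
    by_cases ht : f.coeff (d i + d j) ≠ 0 ∧ v (Gm i j) ≤ v (f.coeff (d i + d j))
    · exact Or.inl (htame i j hG htie ht.1 ht.2)
    · right
      have hwild : f.coeff (d i + d j) = 0 ∨ v (f.coeff (d i + d j)) < v (Gm i j) := by
        by_cases h0 : f.coeff (d i + d j) = 0
        · exact Or.inl h0
        · right; by_contra hge; push Not at hge; exact ht ⟨h0, hge⟩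
      refine ⟨fun heq => ?_, hwild⟩
      subst heq
      obtain ⟨hne, hvle⟩ := hdiag i hG
      rcases hwild with h0 | hlt
      · exact hne h0
      · exact (not_lt.2 hvle) hlt
  intro i j hG htie
  rcases hsplit i j hG htie with hBC | ⟨hij, hwild⟩
  · exact Or.inl hBC
  by_contra hno
  push Not at hno
  obtain ⟨⟨hnB, hnC⟩, hnbetween⟩ := hno
  have hside : max B Cx < d i + d j ∨ d i + d j < min B Cx := by
    by_cases h1 : min B Cx < d i + d j
    · left
      have := hnbetween hij h1
      rcases lt_or_eq_of_le this with h2 | h2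
      · exact h2
      · exfalso
        rcases max_choice B Cx with h3 | h3
        · exact hnB (by rw [← h2, h3])
        · exact hnC (by rw [← h2, h3])
    · right
      push Not at h1
      rcases lt_or_eq_of_le h1 with h2 | h2
      · exact h2
      · exfalso
        rcases min_choice B Cx with h3 | h3
        · exact hnB (by rw [h2, h3])
        · exact hnC (by rw [h2, h3])
  rcases hside with hbig | hsmall
  · -- a wild touching cell beyond `max B Cx`: take one of maximal exponent
    set W : Finset (Fin K × Fin K) := (univ : Finset (Fin K × Fin K)).filter fun c =>
      c.1 < c.2 ∧ Gm c.1 c.2 ≠ 0 ∧ Real.log (v (Gm c.1 c.2)) = h ((d c.1 + d c.2 : ℕ) : ℝ) ∧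
        (f.coeff (d c.1 + d c.2) = 0 ∨ v (f.coeff (d c.1 + d c.2)) < v (Gm c.1 c.2)) ∧ max B Cx < d c.1 + d c.2 with hW
    have hWne : W.Nonempty := by
      rcases lt_or_gt_of_ne hij with h0 | h0
      · exact ⟨(i, j), Finset.mem_filter.2 ⟨Finset.mem_univ _, h0, hG, htie, hwild, hbig⟩⟩
      · refine ⟨(j, i), Finset.mem_filter.2 ⟨Finset.mem_univ _, h0, ?_, ?_, ?_, ?_⟩⟩
        · show Gm j i ≠ 0; rw [hGsymm]; exact hG
        · show Real.log (v (Gm j i)) = h ((d j + d i : ℕ) : ℝ); rw [hGsymm, Nat.add_comm]; exact htie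
        · show f.coeff (d j + d i) = 0 ∨ v (f.coeff (d j + d i)) < v (Gm j i); rw [hGsymm, Nat.add_comm]; exact hwild
        · show max B Cx < d j + d i; rw [Nat.add_comm]; exact hbig
    obtain ⟨c₀, hc₀W, hc₀max⟩ := Finset.exists_max_image W (fun c : Fin K × Fin K => d c.1 + d c.2) hWne
    obtain ⟨-, hlt₀, hG₀, htie₀, hwild₀, hbig₀⟩ := Finset.mem_filter.1 hc₀W
    have hdir : ∀ i' j' : Fin K, Gm i' j' ≠ 0 → Real.log (v (Gm i' j')) = h ((d i' + d j' : ℕ) : ℝ) + 0 →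
        d i' + d j' ≤ d c₀.1 + d c₀.2 := by
      intro i' j' hG' htie'
      rw [add_zero] at htie'
      rcases hsplit i' j' hG' htie' with (hB | hC) | ⟨hne', hw'⟩
      · rw [hB]; exact ((le_max_left B Cx).trans hbig₀.le)
      · rw [hC]; exact ((le_max_right B Cx).trans hbig₀.le)
      · by_cases hsmall' : d i' + d j' ≤ max B Cx
        · exact hsmall'.trans hbig₀.le
        · push Not at hsmall'
          rcases lt_or_gt_of_ne hne' with h0 | h0
          · exact hc₀max (i', j') (Finset.mem_filter.2 ⟨Finset.mem_univ _, h0, hG', htie', hw', hsmall'⟩)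
          · have hmem : (j', i') ∈ W := by
              refine Finset.mem_filter.2 ⟨Finset.mem_univ _, h0, ?_, ?_, ?_, ?_⟩
              · show Gm j' i' ≠ 0; rw [hGsymm]; exact hG'
              · show Real.log (v (Gm j' i')) = h ((d j' + d i' : ℕ) : ℝ); rw [hGsymm, Nat.add_comm]; exact htie'
              · show f.coeff (d j' + d i') = 0 ∨ v (f.coeff (d j' + d i')) < v (Gm j' i')
                rw [hGsymm, Nat.add_comm]; exact hw'
              · show max B Cx < d j' + d i'; rw [Nat.add_comm]; exact hsmall'
            have h5 : d j' + d i' ≤ d c₀.1 + d c₀.2 := hc₀max (j', i') hmem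
            omega
    have htie₀' : Real.log (v (Gm c₀.1 c₀.2)) = h ((d c₀.1 + d c₀.2 : ℕ) : ℝ) + 0 := by rw [add_zero]; exact htie₀
    exact false_of_wild_tying_extremal v hv d hd S hS hap p q p' q' 0 hle0 hlt₀ hG₀ htie₀' hwild₀ (Or.inl hdir)
  · -- a wild touching cell below `min B Cx`: take one of minimal exponent
    set W : Finset (Fin K × Fin K) := (univ : Finset (Fin K × Fin K)).filter fun c =>
      c.1 < c.2 ∧ Gm c.1 c.2 ≠ 0 ∧ Real.log (v (Gm c.1 c.2)) = h ((d c.1 + d c.2 : ℕ) : ℝ) ∧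
        (f.coeff (d c.1 + d c.2) = 0 ∨ v (f.coeff (d c.1 + d c.2)) < v (Gm c.1 c.2)) ∧ d c.1 + d c.2 < min B Cx with hW
    have hWne : W.Nonempty := by
      rcases lt_or_gt_of_ne hij with h0 | h0
      · exact ⟨(i, j), Finset.mem_filter.2 ⟨Finset.mem_univ _, h0, hG, htie, hwild, hsmall⟩⟩
      · refine ⟨(j, i), Finset.mem_filter.2 ⟨Finset.mem_univ _, h0, ?_, ?_, ?_, ?_⟩⟩
        · show Gm j i ≠ 0; rw [hGsymm]; exact hG
        · show Real.log (v (Gm j i)) = h ((d j + d i : ℕ) : ℝ); rw [hGsymm, Nat.add_comm]; exact htie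
        · show f.coeff (d j + d i) = 0 ∨ v (f.coeff (d j + d i)) < v (Gm j i); rw [hGsymm, Nat.add_comm]; exact hwild
        · show d j + d i < min B Cx; rw [Nat.add_comm]; exact hsmall
    obtain ⟨c₀, hc₀W, hc₀min⟩ := Finset.exists_min_image W (fun c : Fin K × Fin K => d c.1 + d c.2) hWne
    obtain ⟨-, hlt₀, hG₀, htie₀, hwild₀, hsmall₀⟩ := Finset.mem_filter.1 hc₀W
    have hdir : ∀ i' j' : Fin K, Gm i' j' ≠ 0 → Real.log (v (Gm i' j')) = h ((d i' + d j' : ℕ) : ℝ) + 0 →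
        d c₀.1 + d c₀.2 ≤ d i' + d j' := by
      intro i' j' hG' htie'
      rw [add_zero] at htie'
      rcases hsplit i' j' hG' htie' with (hB | hC) | ⟨hne', hw'⟩
      · rw [hB]; exact (hsmall₀.le.trans (min_le_left B Cx))
      · rw [hC]; exact (hsmall₀.le.trans (min_le_right B Cx))
      · by_cases hbig' : min B Cx ≤ d i' + d j'
        · exact hsmall₀.le.trans hbig'
        · push Not at hbig'
          rcases lt_or_gt_of_ne hne' with h0 | h0
          · exact hc₀min (i', j') (Finset.mem_filter.2 ⟨Finset.mem_univ _, h0, hG', htie', hw', hbig'⟩)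
          · have hmem : (j', i') ∈ W := by
              refine Finset.mem_filter.2 ⟨Finset.mem_univ _, h0, ?_, ?_, ?_, ?_⟩
              · show Gm j' i' ≠ 0; rw [hGsymm]; exact hG'
              · show Real.log (v (Gm j' i')) = h ((d j' + d i' : ℕ) : ℝ); rw [hGsymm, Nat.add_comm]; exact htie'
              · show f.coeff (d j' + d i') = 0 ∨ v (f.coeff (d j' + d i')) < v (Gm j' i')
                rw [hGsymm, Nat.add_comm]; exact hw'
              · show d j' + d i' < min B Cx; rw [Nat.add_comm]; exact hbig'
            have h5 : d c₀.1 + d c₀.2 ≤ d j' + d i' := hc₀min (j', i') hmem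
            omega
    have htie₀' : Real.log (v (Gm c₀.1 c₀.2)) = h ((d c₀.1 + d c₀.2 : ℕ) : ℝ) + 0 := by rw [add_zero]; exact htie₀
    exact false_of_wild_tying_extremal v hv d hd S hS hap p q p' q' 0 hle0 hlt₀ hG₀ htie₀' hwild₀ (Or.inr hdir)

end Summit.ValiantsHypothesis.ValiantsHypothesis.Theorems.KPlusLogSqLaw.ValDoor
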